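import Summits.FinalStateConjecture.FinalStateConjecture.Theorems.ZeroEnergyKerrOrBombErgoregionBombModTLightPointHessian
import Literature.Geometry.Lorentzian.GeodesicProofs
import Summits.FinalStateConjecture.FinalStateConjecture.Theorems.ZeroEnergyKerrOrBombErgoregionBombModTOffWallReduction

/-!
# A zero-energy escape certificate excludes Killing light points (crux stmt-FinalStateConjecture-17838, line `SketchIdeator4`)

Route `ZeroEnergyKerrOrBomb`, crux `ErgoregionBombModT`, line `SketchIdeator4` (zero-energy escape).  Species (c) of the
crux idea card `Cruxes/ErgoregionBombModT/Ideas/zero-energy-escape.md`: the KERNEL of the line (registered stub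
`stub_zeroEnergyEscapeCertificate`: a zero-energy escape certificate `(W, F, τ, c, C)` on the cage `⋃ₜ φₜ(S)` of every
compact `S ⊆ ⟨⟨M_ext⟩⟩` of every telescope hole) CONTAINS the statement "no Killing light point in the d.o.c."
(`NoDocLightPoints`, hypothesis `hNo` of `ergoregionBombModT_of_offWall_of_noDocLightPoints`, p135563), instead of
assuming it separately:

* `mfderiv_killing_eq_zero_of_flowInvariant` — a function constant along the integral curves of `T` issued from an
  open set `W` has `dF(T) = 0` on `W` (chain rule along the integral curve through the point);
* `mfderiv_killing_eq_one_of_killingTime` — a Killing time (`τ(σ t) = τ(σ 0) + t` along those curves) has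
  `dτ(T) = 1` on `W`;
* `leviCivita_killing_ne_smul_of_certificate` — at a point `p` of the cage with `g(T, T)(p) = 0` the vector `T(p)`
  is a zero-energy null vector, so the certificate gives `Hess F(T, T) ≥ c · dτ(T)² = c > 0`, whereas at a Killing
  light point (`∇_T T = κ T`) every `T`-invariant `C²` function has `Hess F(T, T) = 0`
  (`hessian_killing_killing_eq_zero_of_lightPoint`, p142290): so `p` is not a light point;
* `noDocLightPoints_of_zeroEnergyEscapeCertificate` — the telescope form: the kernel implies `NoDocLightPoints`
  (apply the previous lemma with `S = {p}`).

References: B. O'Neill, *Semi-Riemannian geometry* (1983), Ch. 3, Def. 3.48–Lemma 3.49; A. D. Ionescu, S. Klainerman,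
Invent. Math. 175 (2009) §3 (T-conditional pseudo-convexity fails on characteristic directions); crux workfiles
`Cruxes/ErgoregionBombModT/Ideas/zero-energy-escape.md` (species (c)), `Lines/SketchIdeator4.lean`.
-/

noncomputable section

open Bundle Set Filter Function
open scoped Manifold Topology ContDiff

-- summit = problem name (D-0017)
set_option linter.dupNamespace false

namespace Summit.FinalStateConjecture.FinalStateConjecture.Theorems.ErgoregionBombModT

open Literature.Geometry.Lorentzian

variable (𝓑 : StationaryAFBlackHole.{0}) [𝓑.metric.HasLeviCivita]

/-- The derivative along `T` of a function with prescribed values along the integral curves of `T` issued from an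
open set: if `F (σ t) = F (σ 0) + a t` for every integral curve `σ` of `T` with `σ 0 ∈ W`, and `F` is `C¹` on the
open `W`, then `dF(T) = a` on `W` (chain rule along the integral curve through the point, which exists because the
stationary Killing field is complete). [folklore] -/
theorem mfderiv_killing_eq_of_flow {W : Set 𝓑.carrier} (hW : IsOpen W) {F : 𝓑.carrier → ℝ} {a : ℝ}
    (hF : ContMDiffOn (𝓡 4) 𝓘(ℝ, ℝ) 1 F W)
    (hflow : ∀ σ : ℝ → 𝓑.carrier, IsMIntegralCurve σ 𝓑.killing → σ 0 ∈ W → ∀ t, F (σ t) = F (σ 0) + a * t)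
    {x : 𝓑.carrier} (hx : x ∈ W) : mvfderiv (𝓡 4) F x (𝓑.killing x) = a := by
  obtain ⟨σ, hσ, h0⟩ := 𝓑.isStationaryKilling.isCompleteVectorField x
  subst h0
  have hFd : MDifferentiableAt (𝓡 4) 𝓘(ℝ, ℝ) F (σ 0) := (hF.contMDiffAt (hW.mem_nhds hx)).mdifferentiableAt one_ne_zero
  have hσd : MDifferentiableAt 𝓘(ℝ, ℝ) (𝓡 4) σ 0 := (hσ 0).mdifferentiableAt
  have h1 : HasDerivAt (fun t ↦ F (σ t)) (mfderiv (𝓡 4) 𝓘(ℝ, ℝ) F (σ 0) (velocity (𝓡 4) σ 0)) 0 :=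
    hasDerivAt_comp_curve hFd hσd
  have h2 : HasDerivAt (fun t ↦ F (σ t)) a 0 := by
    have h : (fun t ↦ F (σ t)) = fun t ↦ F (σ 0) + a * t := funext fun t ↦ hflow σ hσ hx t
    rw [h]
    simpa using ((hasDerivAt_id (0 : ℝ)).const_mul a).const_add (F (σ 0))
  have hvel : velocity (𝓡 4) σ 0 = 𝓑.killing (σ 0) := by
    rw [velocity, (hσ 0).mfderiv]
    change ((1 : ℝ →L[ℝ] ℝ) (1 : ℝ)) • 𝓑.killing (σ 0) = 𝓑.killing (σ 0)
    simp
  rw [← hvel]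
  exact h1.unique h2

/-- A function constant along the integral curves of `T` issued from an open set `W`, `C¹` on `W`, has
`dF(T) = 0` on `W`. [folklore] -/
theorem mfderiv_killing_eq_zero_of_flowInvariant {W : Set 𝓑.carrier} (hW : IsOpen W) {F : 𝓑.carrier → ℝ}
    (hF : ContMDiffOn (𝓡 4) 𝓘(ℝ, ℝ) 1 F W)
    (hinv : ∀ σ : ℝ → 𝓑.carrier, IsMIntegralCurve σ 𝓑.killing → σ 0 ∈ W → ∀ t, F (σ t) = F (σ 0))
    {x : 𝓑.carrier} (hx : x ∈ W) : mvfderiv (𝓡 4) F x (𝓑.killing x) = 0 :=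
  mfderiv_killing_eq_of_flow 𝓑 hW hF (a := 0) (fun σ hσ h0 t ↦ by simpa using hinv σ hσ h0 t) hx

/-- A Killing time (`τ(σ t) = τ(σ 0) + t` along the integral curves of `T` issued from an open `W`), `C¹` on `W`,
has `dτ(T) = 1` on `W`. [folklore] -/
theorem mfderiv_killing_eq_one_of_killingTime {W : Set 𝓑.carrier} (hW : IsOpen W) {τ : 𝓑.carrier → ℝ}
    (hτ : ContMDiffOn (𝓡 4) 𝓘(ℝ, ℝ) 1 τ W)
    (heq : ∀ σ : ℝ → 𝓑.carrier, IsMIntegralCurve σ 𝓑.killing → σ 0 ∈ W → ∀ t, τ (σ t) = τ (σ 0) + t)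
    {x : 𝓑.carrier} (hx : x ∈ W) : mvfderiv (𝓡 4) τ x (𝓑.killing x) = 1 :=
  mfderiv_killing_eq_of_flow 𝓑 hW hτ (a := 1) (fun σ hσ h0 t ↦ by simpa using heq σ hσ h0 t) hx

/-- **A zero-energy escape certificate excludes Killing light points on its cage.**  Let `(W, F, τ, c, C)` be a
certificate on the cage `⋃ₜ φₜ(S)`: `W ⊇ ⋃ₜ φₜ(S)` open, `F, τ` of class `C²` on `W`, `F` flow-invariant and `τ` a
Killing time from `W`, `c > 0`, and `c · dτ(k)² ≤ Hess F(k, k)` for every zero-energy null `k` over the cage.  Then at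
no point `p` of the cage with `g(T, T)(p) = 0` is `∇_T T` proportional to `T`: there `T(p)` is a zero-energy null
vector with `dτ(T) = 1`, so `Hess F(T, T) ≥ c > 0`, while `Hess F(T, T) = 0` at a light point for the
`T`-invariant `F` (`hessian_killing_killing_eq_zero_of_lightPoint`).  Species (c) of the zero-energy-escape card. -/
theorem leviCivita_killing_ne_smul_of_certificate {S W : Set 𝓑.carrier} {F τ : 𝓑.carrier → ℝ} {c : ℝ}
    (hW : IsOpen W) (hSW : stationaryOrbit 𝓑.killing S ⊆ W) (hc : 0 < c)
    (hF : ContMDiffOn (𝓡 4) 𝓘(ℝ, ℝ) 2 F W) (hτ : ContMDiffOn (𝓡 4) 𝓘(ℝ, ℝ) 2 τ W)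
    (hinv : ∀ σ : ℝ → 𝓑.carrier, IsMIntegralCurve σ 𝓑.killing → σ 0 ∈ W → ∀ t,
      F (σ t) = F (σ 0) ∧ τ (σ t) = τ (σ 0) + t)
    (hH : ∀ x ∈ stationaryOrbit 𝓑.killing S, ∀ k : TangentSpace (𝓡 4) x, 𝓑.metric.val x k k = 0 →
      𝓑.metric.val x k (𝓑.killing x) = 0 →
        c * (mvfderiv (𝓡 4) τ x k) ^ 2 ≤ 𝓑.metric.toPseudoRiemannianMetric.hessian F x k k)
    {p : 𝓑.carrier} (hp : p ∈ stationaryOrbit 𝓑.killing S)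
    (hlam : 𝓑.metric.val p (𝓑.killing p) (𝓑.killing p) = 0) (κ : ℝ) :
    𝓑.metric.leviCivita 𝓑.killing p (𝓑.killing p) ≠ κ • 𝓑.killing p := by
  intro hacc
  have hpW : p ∈ W := hSW hp
  have hF1 : ContMDiffOn (𝓡 4) 𝓘(ℝ, ℝ) 1 F W := hF.of_le (by norm_num)
  have hτ1 : ContMDiffOn (𝓡 4) 𝓘(ℝ, ℝ) 1 τ W := hτ.of_le (by norm_num)
  -- `dF(T) = 0` near `p` and `dτ(T)(p) = 1`
  have hF0 : ∀ᶠ x in 𝓝 p, mfderiv (𝓡 4) 𝓘(ℝ, ℝ) F x (𝓑.killing x) = 0 := by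
    filter_upwards [hW.mem_nhds hpW] with x hx
    exact mfderiv_killing_eq_zero_of_flowInvariant 𝓑 hW hF1 (fun σ hσ h0 t ↦ (hinv σ hσ h0 t).1) hx
  have hτ1p : mvfderiv (𝓡 4) τ p (𝓑.killing p) = 1 :=
    mfderiv_killing_eq_one_of_killingTime 𝓑 hW hτ1 (fun σ hσ h0 t ↦ (hinv σ hσ h0 t).2) hpW
  -- at a light point the Hessian of the invariant `F` vanishes on `(T, T)`
  have hHess0 : 𝓑.metric.toPseudoRiemannianMetric.hessian F p (𝓑.killing p) (𝓑.killing p) = 0 :=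
    hessian_killing_killing_eq_zero_of_lightPoint 𝓑 F p κ (hF.contMDiffAt (hW.mem_nhds hpW)) hF0 hacc
  -- but the certificate makes it at least `c > 0`
  have h := hH p hp (𝓑.killing p) hlam hlam
  rw [hτ1p, hHess0] at h
  linarith

/-- **The kernel contains `NoDocLightPoints`.**  If every telescope hole carries a zero-energy escape certificate on the
cage of every compact subset of its d.o.c. (hypothesis `hZ`: the registered kernel stub
`stub_zeroEnergyEscapeCertificate` of line `SketchIdeator4` verbatim), then no telescope hole has a Killing light point
in its d.o.c. (conclusion: hypothesis `hNo` of `ergoregionBombModT_of_offWall_of_noDocLightPoints` verbatim) — apply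
`leviCivita_killing_ne_smul_of_certificate` with `S = {p}`. -/
theorem noDocLightPoints_of_zeroEnergyEscapeCertificate
    (hZ : ∀ (𝓑 : Literature.Geometry.Lorentzian.StationaryAFBlackHole.{0}) [𝓑.metric.HasLeviCivita] [Literature.Geometry.Lorentzian.Kerr.Facts], 𝓑.metric.toPseudoRiemannianMetric.IsRicciFlat → 𝓑.IsIPlusRegular → (∀ p : 𝓑.carrier, p ∈ 𝓑.metric.chronologicalFuture 𝓑.timeOrientation 𝓑.Mext) → (∀ p ∈ 𝓑.doc, 𝓑.killing p ≠ 0) → SimplyConnectedSpace 𝓑.doc → ∀ (U : Set 𝓑.carrier) (K : Π x : 𝓑.carrier, TangentSpace (𝓡 4) x), IsOpen U → 𝓑.horizon ⊆ U → IsConnected 𝓑.horizon → ContMDiffOn (𝓡 4) ((𝓡 4).prod 𝓘(ℝ, Literature.Geometry.Lorentzian.E4)) ((⊤ : ℕ∞) : WithTop ℕ∞) (fun x ↦ (Bundle.TotalSpace.mk' Literature.Geometry.Lorentzian.E4 x (K x) : TangentBundle (𝓡 4) 𝓑.carrier)) U → (∀ x ∈ U, ∀ v w : TangentSpace (𝓡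 4) x, 𝓑.metric.val x (𝓑.metric.leviCivita K x v) w + 𝓑.metric.val x v (𝓑.metric.leviCivita K x w) = 0) → (∀ x ∈ U, VectorField.mlieBracket (𝓡 4) 𝓑.killing K x = 0) → (∀ p ∈ 𝓑.horizon, K p ≠ 0) → (∀ γ : ℝ → 𝓑.carrier, IsMIntegralCurve γ K → γ 0 ∈ 𝓑.horizon → ∀ t, γ t ∈ 𝓑.horizon) → (∀ x ∈ U ∩ 𝓑.doc, 𝓑.metric.val x (K x) (K x) < 0) → (∃ S₀ : Set 𝓑.carrier, IsCompact S₀ ∧ S₀ ⊆ 𝓑.doc ∧ ∀ y ∈ 𝓑.doc, 0 ≤ 𝓑.metric.val y (𝓑.killing y) (𝓑.killing y) → y ∉ U → y ∈ Literature.Geometry.Lorentzian.stationaryOrbit 𝓑.killing S₀) → ∀ S : Set 𝓑.carrier, IsCompact S → S ⊆ 𝓑.doc → ∃ (W : Set 𝓑.carrier) (F τ : 𝓑.carrier → ℝ) (c C : ℝ), IsOpen W ∧ Literature.Geometry.Lorentzian.stationaryOrbit 𝓑.killing S ⊆ W ∧ 0 < c ∧ ContMDiffOn (𝓡 4) 𝓘(ℝ,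 ℝ) 2 F W ∧ ContMDiffOn (𝓡 4) 𝓘(ℝ, ℝ) 2 τ W ∧ (∀ σ : ℝ → 𝓑.carrier, IsMIntegralCurve σ 𝓑.killing → σ 0 ∈ W → ∀ t, F (σ t) = F (σ 0) ∧ τ (σ t) = τ (σ 0) + t) ∧ (∀ x ∈ W, ∀ k : TangentSpace (𝓡 4) x, 𝓑.metric.val x k k = 0 → k ≠ 0 → mvfderiv (𝓡 4) τ x k ≠ 0) ∧ ∀ x ∈ Literature.Geometry.Lorentzian.stationaryOrbit 𝓑.killing S, ∀ k : TangentSpace (𝓡 4) x, 𝓑.metric.val x k k = 0 → 𝓑.metric.val x k (𝓑.killing x) = 0 → c * (mvfderiv (𝓡 4) τ x k) ^ 2 ≤ 𝓑.metric.toPseudoRiemannianMetric.hessian F x k k ∧ |𝓑.metric.toPseudoRiemannianMetric.hessian τ x k k| ≤ C * (mvfderiv (𝓡 4) τ x k) ^ 2) :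
    ∀ (𝓑 : Literature.Geometry.Lorentzian.StationaryAFBlackHole.{0}) [𝓑.metric.HasLeviCivita] [Literature.Geometry.Lorentzian.Kerr.Facts], 𝓑.metric.toPseudoRiemannianMetric.IsRicciFlat → 𝓑.IsIPlusRegular → (∀ p : 𝓑.carrier, p ∈ 𝓑.metric.chronologicalFuture 𝓑.timeOrientation 𝓑.Mext) → (∀ p ∈ 𝓑.doc, 𝓑.killing p ≠ 0) → SimplyConnectedSpace 𝓑.doc → ∀ (U : Set 𝓑.carrier) (K : Π x : 𝓑.carrier, TangentSpace (𝓡 4) x), IsOpen U → 𝓑.horizon ⊆ U → IsConnected 𝓑.horizon → ContMDiffOn (𝓡 4) ((𝓡 4).prod 𝓘(ℝ, Literature.Geometry.Lorentzian.E4)) ((⊤ : ℕ∞) : WithTop ℕ∞) (fun x ↦ (Bundle.TotalSpace.mk' Literature.Geometry.Lorentzian.E4 x (K x) : TangentBundle (𝓡 4) 𝓑.carrier)) U → (∀ x ∈ U, ∀ v w : TangentSpace (𝓡 4) x, 𝓑.metric.val x (𝓑.metric.leviCivita K x v) w + 𝓑.metric.val x v (𝓑.metric.leviCivita K x w) = 0)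 → (∀ x ∈ U, VectorField.mlieBracket (𝓡 4) 𝓑.killing K x = 0) → (∀ p ∈ 𝓑.horizon, K p ≠ 0) → (∀ γ : ℝ → 𝓑.carrier, IsMIntegralCurve γ K → γ 0 ∈ 𝓑.horizon → ∀ t, γ t ∈ 𝓑.horizon) → (∀ x ∈ U ∩ 𝓑.doc, 𝓑.metric.val x (K x) (K x) < 0) → (∃ S₀ : Set 𝓑.carrier, IsCompact S₀ ∧ S₀ ⊆ 𝓑.doc ∧ ∀ y ∈ 𝓑.doc, 0 ≤ 𝓑.metric.val y (𝓑.killing y) (𝓑.killing y) → y ∉ U → y ∈ Literature.Geometry.Lorentzian.stationaryOrbit 𝓑.killing S₀) → ∀ p ∈ 𝓑.doc, 𝓑.metric.val p (𝓑.killing p) (𝓑.killing p) = 0 → ∀ κ : ℝ, 𝓑.metric.leviCivita 𝓑.killing p (𝓑.killing p) ≠ κ • 𝓑.killing p := by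
  intro 𝓑 _ _ h1 h2 h3 h4 h5 U K hU hHU hc hK hKill hbr hK0 htan htl hbelt p hp hlam κ
  obtain ⟨W, F, τ, c, C, hW, hSW, hc0, hF, hτ, hinv, -, hH⟩ :=
    hZ 𝓑 h1 h2 h3 h4 h5 U K hU hHU hc hK hKill hbr hK0 htan htl hbelt {p} isCompact_singleton
      (singleton_subset_iff.2 hp)
  exact leviCivita_killing_ne_smul_of_certificate 𝓑 hW hSW hc0 hF hτ hinv
    (fun x hx k hk hkT ↦ (hH x hx k hk hkT).1)
    (subset_stationaryOrbit 𝓑.isStationaryKilling.isCompleteVectorField _ (mem_singleton p)) hlam κ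

end Summit.FinalStateConjecture.FinalStateConjecture.Theorems.ErgoregionBombModT

end
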